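import Summits.ValiantsHypothesis.ValiantsHypothesis.Theorems.GrenetZeonDualUnipotentThreeHalvesLongMassMixedWords

/-!
# `GrenetZeon.DualUnipotentThreeHalves` (stmt-ValiantsHypothesis-24318), line `slow_core`, stub (c) `SlowCore.LongMassSlowLawInv`:
# THE FLAG ENGINE in the algebraic currency — words with many deep letters vanish; the intrinsic COARSENING certificate

The converse-side companion of ✓ `window_iff_mixedWords` (`…LongMassMixedWords`): the one SUFFICIENT mechanism behind every «graded» row of the
cell (flag / band / level certificates, block coarsening of `𝔫_b`), stated without pencils or coordinates.  Let `F : ℕ → Submodule ℂ ℂ^b` be a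
monotone filtration with `F 0 = ⊥`, `F L = ⊤`.  Say a matrix `M` DROPS `d` levels if `M · F(i + d) ≤ F(i)` for all `i`.

* ★ `mulVec_prod_mem_of_drops` — a word whose letters drop `d_1, …, d_p` levels maps `F(i + Σ d_t)` into `F(i)`;
* ★★ `word_eq_zero_of_drops` — hence a word of total drop `≥ L` VANISHES;
* ★★★ `window_of_flag` — if every `A ∈ V` drops `1` level and every `w ∈ W` drops `r` levels, then `(V, W)` has the window property at every
  order `k` with `L ≤ (k + 1)·r` (each word with `q > k` letters `w` has total drop `≥ q·r ≥ L`), for EVERY window `n`.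

So, intrinsically: a nilpotent `V` adapted to a flag of length `L` is certified by its deep part `W = {w ∈ V : w drops r}` at order `⌈L/r⌉ − 1`;
with `codim_V W ≤ #(short positions)` this is the block-coarsening price of the triangularisable rows (✓ `relCert_of_acyclicSupport`, pencil
currency) — now available to a seat working in the submodule / mixed-word currency of ✓ `longMassSlowLawInv_iff_mixedWords`.
Honest framing.  A sufficient-condition engine (`--supports stmt-ValiantsHypothesis-24318`), NOT progress on (c): (c) `SlowCore.LongMassSlowLawInv`,
S3, the crux 24318, 8062 and `VP ≠ VNP` remain OPEN / NOT proved.  No sorry, no definitions, no named facts.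
-/

-- single-conjunct layout: Sub = Summit, duplicated namespace component intended (the name is mandated)
set_option linter.dupNamespace false
set_option autoImplicit false

noncomputable section

namespace Summit.ValiantsHypothesis.ValiantsHypothesis.Theorems.GrenetZeon.LongMassHomogenise

open MvPolynomial Matrix
open scoped BigOperators

variable {b : ℕ}

/-! ## §1 Words along a flag -/

/-- ★ A word whose `t`-th letter drops `d t` levels of the monotone filtration `F` maps `F (i + Σ_t d t)` into `F i`. -/
theorem mulVec_prod_mem_of_drops (F : ℕ → Submodule ℂ (Fin b → ℂ)) (hmono : Monotone F) :
    ∀ (p : ℕ) (M : Fin p → Matrix (Fin b) (Fin b) ℂ) (d : Fin p → ℕ),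
      (∀ t i, ∀ v ∈ F (i + d t), (M t).mulVec v ∈ F i) →
      ∀ i, ∀ v ∈ F (i + ∑ t, d t), ((List.ofFn M).prod).mulVec v ∈ F i
  | 0, M, d, _, i, v, hv => by
    rw [List.ofFn_zero, List.prod_nil, Matrix.one_mulVec]
    simpa using hv
  | p + 1, M, d, hM, i, v, hv => by
    rw [List.ofFn_succ, List.prod_cons, ← Matrix.mulVec_mulVec]
    refine hM 0 i _ (mulVec_prod_mem_of_drops F hmono p (fun t => M t.succ) (fun t => d t.succ) (fun t => hM t.succ) (i + d 0) v ?_)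
    rw [Fin.sum_univ_succ, ← add_assoc] at hv
    exact hv

/-- ★★ **WORDS OF TOTAL DROP `≥ L` VANISH** (`F 0 = ⊥`, `F L = ⊤`). -/
theorem word_eq_zero_of_drops (F : ℕ → Submodule ℂ (Fin b → ℂ)) (hmono : Monotone F) (hF0 : F 0 = ⊥) {L : ℕ} (hFL : F L = ⊤)
    {p : ℕ} (M : Fin p → Matrix (Fin b) (Fin b) ℂ) (d : Fin p → ℕ) (hM : ∀ t i, ∀ v ∈ F (i + d t), (M t).mulVec v ∈ F i)
    (hL : L ≤ ∑ t, d t) : (List.ofFn M).prod = 0 := by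
  have hall : ∀ v : Fin b → ℂ, ((List.ofFn M).prod).mulVec v = 0 := by
    intro v
    have hv : v ∈ F (0 + ∑ t, d t) := by
      rw [zero_add]
      exact hmono hL (by rw [hFL]; exact Submodule.mem_top)
    have := mulVec_prod_mem_of_drops F hmono p M d hM 0 v hv
    rwa [hF0, Submodule.mem_bot] at this
  ext i j
  have := congr_fun (hall (Pi.single j 1)) i
  rw [Matrix.mulVec_single_one] at this
  rw [Matrix.zero_apply]
  simpa using this

/-! ## §2 The intrinsic coarsening certificate -/

/-- ★★★ **THE FLAG ENGINE.**  If every `A ∈ V` drops one level and every `w ∈ W` drops `r` levels of a monotone filtration `F` with `F 0 = ⊥`,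
`F L = ⊤`, and `L ≤ (k + 1)·r`, then `(V, W)` has the window property at order `k`, for every window `n`. -/
theorem window_of_flag (F : ℕ → Submodule ℂ (Fin b → ℂ)) (hmono : Monotone F) (hF0 : F 0 = ⊥) {L : ℕ} (hFL : F L = ⊤)
    (V W : Submodule ℂ (Matrix (Fin b) (Fin b) ℂ)) (r k : ℕ) (hL : L ≤ (k + 1) * r)
    (hV : ∀ A ∈ V, ∀ i, ∀ v ∈ F (i + 1), A.mulVec v ∈ F i) (hW : ∀ w ∈ W, ∀ i, ∀ v ∈ F (i + r), w.mulVec v ∈ F i) (n : ℕ) :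
    ∀ A ∈ V, ∀ w ∈ W, ∀ p : ℕ, p ≤ n - 1 → ∀ i j : Fin b,
      ((((A.map (C : ℂ → MvPolynomial (Fin 1) ℂ) + (X 0 : MvPolynomial (Fin 1) ℂ) • w.map C) ^ p :
        Matrix (Fin b) (Fin b) (MvPolynomial (Fin 1) ℂ)) i j).totalDegree ≤ k) := by
  rw [window_iff_mixedWords]
  intro A hA w hw p _ q hq
  refine Finset.sum_eq_zero fun ε hε => ?_
  rw [Finset.mem_filter] at hε
  refine word_eq_zero_of_drops F hmono hF0 hFL _ (fun t => if ε t then r else 1) (fun t i v hv => ?_) ?_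
  · by_cases h : ε t
    · simp only [h, if_true] at hv ⊢
      exact hW w hw i v hv
    · simp only [h, if_false, Bool.false_eq_true] at hv ⊢
      exact hV A hA i v hv
  · -- total drop `≥ q·r ≥ (k+1)·r ≥ L`
    have hsum : q * r ≤ ∑ t, (if ε t then r else 1) := by
      rw [← hε.2, Finset.sum_mul]
      refine Finset.sum_le_sum fun t _ => ?_
      split_ifs <;> simp
    calc L ≤ (k + 1) * r := hL
      _ ≤ q * r := Nat.mul_le_mul_right r hq
      _ ≤ _ := hsum

end Summit.ValiantsHypothesis.ValiantsHypothesis.Theorems.GrenetZeon.LongMassHomogenise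

end
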